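import Summits.AtomisticToContinuum.Crystallization.Theorems.ThreeConeCertificateSlackRigidityTransfer
import Summits.AtomisticToContinuum.Crystallization.Theorems.ThreeConeCertificateSlackRigidityLayeringIdeal
import Summits.AtomisticToContinuum.Crystallization.Theorems.ThreeConeCertificateSlackRigidityLayeringOffIdeal

/-!
# Crux `SlackRigidity` (stmt-AtomisticToContinuum-11960), line `c-layer-witness-strictness`:
# the TRANSFER `C⁺ ⇒ SlackRigidity`, unconditional in the layering

With both layering stubs landed (`CLayerWitnessLayeringIdeal.stub_layeringIdeal` at the ideal
ratio `h² = 2a²/3` via Hales's *Dense Sphere Packings* §1.3, `CLayerWitnessLayering.stub_layeringOffIdeal`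
off it), the layering hypothesis of `slackRigidity_of_layering_of_strictCertificate`
(`ThreeConeCertificateSlackRigidityTransfer.lean`) is discharged by cases, and the crux
`ThreeConeCertificate.SlackRigidity` is reduced, in the tree, to ONE existential statement: the
STRICT STAR CERTIFICATE `stub_strictCertificate` of the line (the route's open crux
`ExactCertificate`, stmt-11959, at `P = hcp(a,h)`, plus strict complementarity (S1)/(S2) and
regularity of the star functional).  [folklore]
-/

noncomputable section

namespace Summit.AtomisticToContinuum.Crystallization.Theorems.CLayerWitnessReduction

open scoped BigOperators
open Literature.MathematicalPhysics.StatisticalMechanics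
open Summit.AtomisticToContinuum.Crystallization.Theses.ThreeConeCertificate (SlackRigidity)
open Summit.AtomisticToContinuum.Crystallization.Theorems.SlackRigidityNegative (E3)

/-- **Layering on the whole window** `0.775a < h < 0.894a` (landed stubs 5a + 5b, by cases on the
ideal ratio): a set `Y ∋ 0` all of whose `6a/5`-stars are exact linearly rotated Barlow 13-point
stars of spacing `(a, h)` is one linearly rotated Barlow stacking. [cite: HalesDSP2012, §1.3] -/
theorem layering_of_exact_stars :
    ∀ (a h : ℝ), 0 < a → 0 < h → 0.775 * a < h → h < 0.894 * a →
    ∀ Y : Set E3, (0 : E3) ∈ Y →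
      (∀ y ∈ Y, ∃ s : ℤ → ℤ, IsHaggSeq s ∧ ∃ B : E3 →ₗᵢ[ℝ] E3,
        ((fun z => z - y) '' Y) ∩ Metric.closedBall 0 (6 * a / 5) =
          B '' (barlowStacking a h s ∩ Metric.closedBall 0 (6 * a / 5))) →
      ∃ s : ℤ → ℤ, IsHaggSeq s ∧ ∃ A : E3 →ₗᵢ[ℝ] E3, Y = A '' barlowStacking a h s := by
  intro a h ha hh hw1 hw2 Y hY0 hloc
  by_cases hid : h ^ 2 = 2 * a ^ 2 / 3
  · exact CLayerWitnessLayeringIdeal.stub_layeringIdeal a h ha hh hid Y hY0 hloc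
  · exact CLayerWitnessLayering.stub_layeringOffIdeal a h ha hh hw1 hw2 hid Y hY0 hloc

/-- **The transfer `C⁺ ⇒ crux`, kernel-checked**: the strict star certificate (statement of the
line's stub `stub_strictCertificate`, verbatim) implies `SlackRigidity`. [folklore] -/
theorem slackRigidity_of_strictCertificate :
    (∃ (a h : ℝ) (ha : 0 < a) (hh : 0 < h), 0.775 * a < h ∧ h < 0.894 * a ∧
    ∃ (ρ c ρ' : ℝ) (g U f : ℝ → ℝ) (F : Set E3 → ℝ),
      (∀ r : ℝ, 0 < r → lennardJones r = g r + U r + f r) ∧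
      (∀ r : ℝ, 0 < r → 0 ≤ U r) ∧
      ContinuousOn U (Set.Ioi 0) ∧
      (∀ r : ℝ, ρ ≤ r → g r = 0) ∧
      (∀ (n : ℕ) (y : Fin n → E3) (w : Fin n → ℝ),
        0 ≤ ∑ i, ∑ j, w i * w j * f (dist (y i) (y j))) ∧
      (∀ T : Set E3, 0 ≤ F T) ∧
      (∀ (N : ℕ) (x : Fin N → E3), Function.Injective x →
        ∑ i, F (((fun z => z - x i) '' Set.range x) ∩ Metric.closedBall 0 ρ') ≤
          interactionEnergy g x + c * N) ∧
      (∀ ε : ℝ, 0 < ε → ∃ η : ℝ, 0 < η ∧ ∀ S T : Set E3,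
        (∀ p ∈ S, ∀ q ∈ S, p ≠ q → (1 / 3 : ℝ) ≤ dist p q) →
        (∀ p ∈ T, ∀ q ∈ T, p ≠ q → (1 / 3 : ℝ) ≤ dist p q) →
        (0 : E3) ∈ S → (0 : E3) ∈ T → BallMatch η (ρ' + 1) 0 S T →
        |F (S ∩ Metric.closedBall 0 ρ') - F (T ∩ Metric.closedBall 0 ρ')| ≤ ε) ∧
      (∀ T : Set E3, (∀ p ∈ T, ∀ q ∈ T, p ≠ q → (1 / 3 : ℝ) ≤ dist p q) → (0 : E3) ∈ T →
        F (T ∩ Metric.closedBall 0 ρ') = 0 →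
        ∃ s : ℤ → ℤ, IsHaggSeq s ∧ ∃ B : E3 →ₗᵢ[ℝ] E3,
          T ∩ Metric.closedBall 0 (6 * a / 5) =
            B '' (barlowStacking a h s ∩ Metric.closedBall 0 (6 * a / 5))) ∧
      0 < U (Real.sqrt (16 * a ^ 2 / 3 + 4 * h ^ 2)) ∧
      c + f 0 / 2 = -((hcpPeriodicConfiguration ha.ne' hh.ne').energyPerParticle lennardJones)) →
    SlackRigidity :=
  slackRigidity_of_layering_of_strictCertificate layering_of_exact_stars

end Summit.AtomisticToContinuum.Crystallization.Theorems.CLayerWitnessReduction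

end
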